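import HarnessLib
import Summits.CriticalPhenomena.Ising3DConformalLimit.Theorems.HarmonicMomentsIsotropyTwoPointAsymptoticIsotropyRayScaling

/-!
# Vague asymptotic isotropy of the critical `ℤ³` two-point function, XXX-A:
# CONVERGENT RAY RATIOS — on each ray the ratio limits are powers
(route HarmonicMomentsIsotropy, support item stmt-CriticalPhenomena-6036 `TwoPointAsymptoticIsotropy`;
ray-regular-variation line of seat c4, exponent-free form, first half)

Write `G = criticalTwoPoint 3`. File XXIX proved the milestone under RAY REGULAR VARIATION with a
common exponent `a` (`G(kmx)/G(mx) → k^{-a}` on every lattice ray). Here the exponent is removed from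
the hypothesis altogether:

`RayRatios`: for every `x ∈ ℤ³ ∖ {0}` and every `k ≥ 1` the ray ratio `m ↦ G(k m x) / G(m x)`
CONVERGES (to some limit, a priori depending on the ray and on `k`). This first half shows that the
limits on each ray are automatically POWERS `k^{-a_x}`:
* `uniformRegularity_of_rayRatios` — the axis ratio at `k = 2` gives doubling, hence uniform
  regularity and cluster points of the pinned zoom (files XXVIII, XXIX);
* `kernel_ray_scaling_of_tendsto` — for a cluster kernel `K` and a ray `x`,
  `K(k s x̂) = L_{x,k} K(s x̂)` with `L_{x,k}` the ratio limit (continuous convergence at moving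
  rescaled sites);
* `exists_rpow_of_rayRatios` — the continuous positive function `f(s) = K(s x̂)` satisfies
  `f(cs) = M(c) f(s)` for all real `c > 0` with `M` continuous and multiplicative, hence
  `M(c) = c^{-a_x}` (Cauchy's equation for the continuous additive `t ↦ log M(eᵗ)`), and
  `L_{x,k} = k^{-a_x}`.
The second half (`…OfRayRatios`) equates the exponents of all rays and concludes the milestone.

References: H. Duminil-Copin, ICM 2022, §8.1, §8.4 [DuminilCopinICM2022]; A. Messager,
S. Miracle-Solé, J. Stat. Phys. 17 (1977) [MessagerMiracleSoleJSP1977]; N. H. Bingham, C. M. Goldie,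
J. L. Teugels, *Regular Variation* (CUP 1987), §1.9. No definitions are introduced (`RayRatios` is a
local notation).
-/

noncomputable section

namespace Summit.CriticalPhenomena.Ising3DConformalLimit.HarmonicMomentsIsotropyTwoPoint.RayRV

open Literature.Probability.LatticeModels Filter Set
open scoped Topology
open Summit.CriticalPhenomena.Ising3DConformalLimit.MoebiusLimitExistsOnlyInteraction (rhoPin rhoPin_pos)
open Summit.CriticalPhenomena.Ising3DConformalLimit.MoebiusLimitExistsNegative
  (rescaled_pin_cfg0s tendsto_div_succ_nhdsGT)
open Summit.CriticalPhenomena.Ising3DConformalLimit.HyperoctahedralRPTwoPoint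
open Summit.CriticalPhenomena.Ising3DConformalLimit.Theses
open Summit.CriticalPhenomena.Ising3DConformalLimit.Cruxes.ExistsScaleCovariantLimit.TwoHierarchies
  (continuousOn_seqLimit stub_twoPointDoubling_of_dyadicPairRatio)
open Summit.CriticalPhenomena.Ising3DConformalLimit.Cruxes.ExistsScaleCovariantLimit.TwoHierarchies.ItemMaps
  (uniformRegularity_of_doubling eventually_mem_Ioo_of_tendsto_nhdsGT')

/-- `RayRatios`: CONVERGENCE OF THE RAY RATIOS — on every lattice ray `ℕ·x`, `x ∈ ℤ³ ∖ {0}`, and for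
every `k ≥ 1`, the ratio `⟨σ₀σ_{kmx}⟩_{β_c} / ⟨σ₀σ_{mx}⟩_{β_c}` converges as `m → ∞` (to an
unspecified limit) (local notation, no new definition). -/
local notation3 (prettyPrint := false) "RayRatios" =>
  ∀ x : Site 3, x ≠ 0 → ∀ k : ℕ, 1 ≤ k → ∃ L : ℝ,
    Tendsto (fun m : ℕ => criticalTwoPoint 3 (fun i => ((k * m : ℕ) : ℤ) * x i) /
      criticalTwoPoint 3 (fun i => ((m : ℕ) : ℤ) * x i)) atTop (𝓝 L)

/-! ### Cluster points from one convergent axis ratio -/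

/-- The axis unit vector `e₀ ∈ ℤ³` is non-zero. [folklore] -/
theorem single_one_ne_zero : (Pi.single (0 : Fin 3) (1 : ℤ) : Site 3) ≠ 0 := by
  intro h
  have := congr_fun h 0
  simp at this

/-- If the axis doubling ratio `g(2m)/g(m)` converges, so does the dyadic pair ratio of the pinned
zoom, `g(2^{j+1})/g(2^j)` (a subsequence). [cite: AizenmanDuminilCopinAnnals2021, Remark 5.10] -/
theorem tendsto_dyadicPairRatio_of_tendsto {L : ℝ}
    (hL : Tendsto (fun m : ℕ => criticalTwoPoint 3 (fun i => ((2 * m : ℕ) : ℤ) *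
        (Pi.single (0 : Fin 3) (1 : ℤ) : Site 3) i) /
      criticalTwoPoint 3 (fun i => ((m : ℕ) : ℤ) * (Pi.single (0 : Fin 3) (1 : ℤ) : Site 3) i))
      atTop (𝓝 L)) :
    Tendsto (fun j : ℕ => rescaledCorrelator (criticalCorr 3) rhoPin 2 (((2:ℝ) ^ j)⁻¹)
      (![0, EuclideanSpace.single 0 (2:ℝ)] : Fin 2 → EuclideanSpace ℝ (Fin 3))) atTop (𝓝 L) := by
  have h2 := hL.comp (tendsto_pow_atTop_atTop_of_one_lt (one_lt_two : (1:ℕ) < 2))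
  refine h2.congr fun j => ?_
  simp only [Function.comp_apply]
  rw [rescaled_pin_cfg0s, intMul_single_one, intMul_single_one]
  have hf1 : ⌊(2:ℝ) / ((2:ℝ) ^ j)⁻¹⌋ = ((2 * 2 ^ j : ℕ) : ℤ) := by
    rw [div_inv_eq_mul, show (2:ℝ) * 2 ^ j = ((2 * 2 ^ j : ℕ) : ℝ) by push_cast; ring,
      Int.floor_natCast]
  have hf2 : ⌊(1:ℝ) / ((2:ℝ) ^ j)⁻¹⌋ = ((2 ^ j : ℕ) : ℤ) := by
    rw [div_inv_eq_mul, one_mul, show (2:ℝ) ^ j = ((2 ^ j : ℕ) : ℝ) by push_cast; ring,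
      Int.floor_natCast]
  rw [hf1, hf2]

/-- **Convergent ray ratios give `UniformRegularity`** (item 4658) of the pinned zoom: the axis ratio at
`k = 2` gives `TwoPointDoubling` (`stub_twoPointDoubling_of_dyadicPairRatio`), and the tree's
`uniformRegularity_of_doubling` applies. [cite: DuminilCopinICM2022, §8.4] -/
theorem uniformRegularity_of_rayRatios (hR : RayRatios) : MonotoneRG.UniformRegularity := by
  obtain ⟨L, hL⟩ := hR (Pi.single 0 1) single_one_ne_zero 2 (by norm_num)
  exact uniformRegularity_of_doubling
    (stub_twoPointDoubling_of_dyadicPairRatio ⟨L, tendsto_dyadicPairRatio_of_tendsto hL⟩)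

/-! ### The ratio limits scale the cluster kernels along rays -/

/-- **Ray scaling of a cluster kernel by a ratio limit.** For a sequential pair limit `S₂`
(renormalisation `ρ > 0` on `(0,1]`, `S₂ > 0` off the diagonal), a lattice direction `x ≠ 0`, `s > 0`,
`k ≥ 1`, if `G(kmx)/G(mx) → L` then `S₂(0, (k s) x̂) = L · S₂(0, s x̂)` — both values are limits of the
renormalised correlator at the moving rescaled sites `u_j⌊s/u_j⌋ x̂`, whose ratio is the lattice ratio
along `m_j = ⌊s/u_j⌋ → ∞`. [cite: DuminilCopinICM2022, §8.4] -/
theorem kernel_ray_scaling_of_tendsto {ρ : ℝ → ℝ}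
    (hρ : ∀ δ ∈ Set.Ioc (0:ℝ) 1, 0 < ρ δ) {u : ℕ → ℝ} (hu : Tendsto u atTop (𝓝[>] (0 : ℝ)))
    {S2 : (Fin 2 → EuclideanSpace ℝ (Fin 3)) → ℝ}
    (hconv2 : TendstoLocallyUniformlyOn (fun k => rescaledCorrelator (criticalCorr 3) ρ 2 (u k)) S2 atTop
      (NonCoincident 3 2))
    (hpos : ∀ z ∈ NonCoincident 3 2, 0 < S2 z)
    {x : Site 3} (hx : x ≠ 0) {s : ℝ} (hs : 0 < s) {k : ℕ} (hk : 1 ≤ k) {L : ℝ}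
    (hL : Tendsto (fun m : ℕ => criticalTwoPoint 3 (fun i => ((k * m : ℕ) : ℤ) * x i) /
      criticalTwoPoint 3 (fun i => ((m : ℕ) : ℤ) * x i)) atTop (𝓝 L)) :
    S2 ![0, ((k : ℝ) * s) • siteVec x] = L * S2 ![0, s • siteVec x] := by
  set m : ℕ → ℕ := fun j => ⌊s / u j⌋₊ with hm
  have hk0 : (0 : ℝ) < k := by exact_mod_cast hk
  have hxv : siteVec x ≠ 0 := siteVec_ne_zero hx
  have hsx : s • siteVec x ≠ 0 := smul_ne_zero hs.ne' hxv
  have hksx : ((k : ℝ) * s) • siteVec x ≠ 0 := smul_ne_zero (mul_pos hk0 hs).ne' hxv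
  have hA : Tendsto (fun j => ρ (u j) ^ 2 * criticalTwoPoint 3 (fun i => ((m j : ℕ) : ℤ) * x i))
      atTop (𝓝 (S2 ![0, s • siteVec x])) := by
    refine tendsto_rescaled_movingSite hu hconv2 hsx ?_
    have h := (tendsto_mul_natFloor_div hu hs).smul_const (siteVec x)
    refine h.congr fun j => ?_
    simp only [hm, siteVec_intMul, smul_smul]
    push_cast
    ring_nf
  have hB : Tendsto (fun j => ρ (u j) ^ 2 * criticalTwoPoint 3 (fun i => ((k * m j : ℕ) : ℤ) * x i))
      atTop (𝓝 (S2 ![0, ((k : ℝ) * s) • siteVec x])) := by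
    refine tendsto_rescaled_movingSite hu hconv2 hksx ?_
    have h := ((tendsto_mul_natFloor_div hu hs).const_mul (k : ℝ)).smul_const (siteVec x)
    refine h.congr fun j => ?_
    simp only [hm, siteVec_intMul, smul_smul]
    push_cast
    ring_nf
  have hmtop : Tendsto m atTop atTop := by
    have h1 : Tendsto (fun j => s / u j) atTop atTop := by
      have h := (tendsto_inv_nhdsGT_zero.comp hu).const_mul_atTop hs
      refine h.congr fun j => ?_
      simp [div_eq_mul_inv]
    exact tendsto_nat_floor_atTop.comp h1
  have hR := hL.comp hmtop
  have hApos : 0 < S2 ![0, s • siteVec x] := hpos _ (zero_pair_mem_nonCoincident hsx)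
  have hQ := hB.div hA hApos.ne'
  have hev : ∀ᶠ j in atTop, ρ (u j) ^ 2 * criticalTwoPoint 3 (fun i => ((k * m j : ℕ) : ℤ) * x i) /
      (ρ (u j) ^ 2 * criticalTwoPoint 3 (fun i => ((m j : ℕ) : ℤ) * x i)) =
      criticalTwoPoint 3 (fun i => ((k * m j : ℕ) : ℤ) * x i) /
        criticalTwoPoint 3 (fun i => ((m j : ℕ) : ℤ) * x i) := by
    filter_upwards [eventually_mem_Ioo_of_tendsto_nhdsGT' hu one_pos] with j hj
    have hρj : 0 < ρ (u j) := hρ _ ⟨hj.1, hj.2.le⟩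
    rw [mul_div_mul_left _ _ (pow_pos hρj 2).ne']
  have hlim := tendsto_nhds_unique (hQ.congr' hev) hR
  rw [div_eq_iff hApos.ne'] at hlim
  exact hlim

/-- **On each ray the ratio limits are powers.** If all ray ratios along `x ≠ 0` converge and a
sequential pair limit exists (renormalisation `ρ > 0`, positive limit), then for some `a` the ratio
`G(kmx)/G(mx)` tends to `k^{-a}` for every `k ≥ 1`: the continuous positive function
`f(s) = S₂(0, s x̂)` satisfies `f(cs) = M(c) f(s)` for all real `c > 0`, with `M` continuous and
multiplicative, hence a power (Cauchy's functional equation for the continuous additive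
`t ↦ log M(eᵗ)`). [cite: DuminilCopinICM2022, §8.4] -/
theorem exists_rpow_of_rayRatios {ρ : ℝ → ℝ}
    (hρ : ∀ δ ∈ Set.Ioc (0:ℝ) 1, 0 < ρ δ) {u : ℕ → ℝ} (hu : Tendsto u atTop (𝓝[>] (0 : ℝ)))
    {S2 : (Fin 2 → EuclideanSpace ℝ (Fin 3)) → ℝ}
    (hconv2 : TendstoLocallyUniformlyOn (fun k => rescaledCorrelator (criticalCorr 3) ρ 2 (u k)) S2 atTop
      (NonCoincident 3 2))
    (hpos : ∀ z ∈ NonCoincident 3 2, 0 < S2 z)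
    {x : Site 3} (hx : x ≠ 0)
    (hR : ∀ k : ℕ, 1 ≤ k → ∃ L : ℝ,
      Tendsto (fun m : ℕ => criticalTwoPoint 3 (fun i => ((k * m : ℕ) : ℤ) * x i) /
        criticalTwoPoint 3 (fun i => ((m : ℕ) : ℤ) * x i)) atTop (𝓝 L)) :
    ∃ a : ℝ, ∀ k : ℕ, 1 ≤ k →
      Tendsto (fun m : ℕ => criticalTwoPoint 3 (fun i => ((k * m : ℕ) : ℤ) * x i) /
        criticalTwoPoint 3 (fun i => ((m : ℕ) : ℤ) * x i)) atTop (𝓝 ((k : ℝ) ^ (-a))) := by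
  have hxv : siteVec x ≠ 0 := siteVec_ne_zero hx
  -- the ray function and its continuity / positivity
  set f : ℝ → ℝ := fun s => S2 ![0, s • siteVec x] with hf
  have hfpos : ∀ s, 0 < s → 0 < f s := fun s hs =>
    hpos _ (zero_pair_mem_nonCoincident (smul_ne_zero hs.ne' hxv))
  have hKcont : ContinuousOn (fun w : EuclideanSpace ℝ (Fin 3) => S2 ![0, w]) {0}ᶜ :=
    (continuousOn_seqLimit hu hconv2).comp continuous_zeroPair.continuousOn
      fun _ hw => zero_pair_mem_nonCoincident hw
  have hfcont : ContinuousOn f (Set.Ioi 0) := by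
    refine hKcont.comp (continuous_id.smul continuous_const).continuousOn fun s hs => ?_
    exact smul_ne_zero (ne_of_gt hs) hxv
  have hfat : ∀ s, 0 < s → ContinuousAt f s := fun s hs =>
    hfcont.continuousAt (Ioi_mem_nhds hs)
  -- the ratio limits and the scaling identities
  choose! Lk hLk using hR
  have hscale : ∀ k : ℕ, 1 ≤ k → ∀ s, 0 < s → f ((k : ℝ) * s) = Lk k * f s := fun k hk s hs =>
    kernel_ray_scaling_of_tendsto hρ hu hconv2 hpos hx hs hk (hLk k hk)
  have hLkpos : ∀ k : ℕ, 1 ≤ k → 0 < Lk k := by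
    intro k hk
    have h := hscale k hk 1 one_pos
    rw [mul_one] at h
    have hk0 : (0:ℝ) < k := by exact_mod_cast hk
    nlinarith [hfpos k hk0, hfpos 1 one_pos]
  -- `M(c) = f(c)/f(1)` and the identity `f(c s) = M(c) f(s)`
  set M : ℝ → ℝ := fun c => f c / f 1 with hM
  have hrat : ∀ (k l : ℕ), 1 ≤ k → 1 ≤ l → ∀ s, 0 < s →
      f ((k : ℝ) / l * s) = Lk k / Lk l * f s := by
    intro k l hk hl s hs
    have hl0 : (0:ℝ) < l := by exact_mod_cast hl
    have h1 := hscale k hk (s / l) (div_pos hs hl0)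
    have h2 := hscale l hl (s / l) (div_pos hs hl0)
    rw [mul_div_cancel₀ _ hl0.ne'] at h2
    rw [show (k : ℝ) / l * s = k * (s / l) by ring, h1, h2, ← mul_assoc,
      div_mul_cancel₀ _ (hLkpos l hl).ne']
  have hMrat : ∀ (k l : ℕ), 1 ≤ k → 1 ≤ l → M ((k : ℝ) / l) = Lk k / Lk l := by
    intro k l hk hl
    have h := hrat k l hk hl 1 one_pos
    rw [mul_one] at h
    rw [hM]
    simp only []
    rw [h, mul_div_assoc, div_self (hfpos 1 one_pos).ne', mul_one]
  have hMid : ∀ c, 0 < c → ∀ s, 0 < s → f (c * s) = M c * f s := by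
    intro c hc s hs
    -- rational approximations `q_N = ⌊(N+1)c⌋/(N+1) → c`
    set δ : ℕ → ℝ := fun N => 1 / ((N:ℝ) + 1) with hδ
    have hδlim : Tendsto δ atTop (𝓝[>] (0:ℝ)) := tendsto_div_succ_nhdsGT one_pos
    set kN : ℕ → ℕ := fun N => ⌊c / δ N⌋₊ with hkN
    set q : ℕ → ℝ := fun N => δ N * (kN N : ℝ) with hq
    have hqlim : Tendsto q atTop (𝓝 c) := tendsto_mul_natFloor_div hδlim hc
    have hkev : ∀ᶠ N in atTop, 1 ≤ kN N := by
      have h1 : Tendsto (fun N => c / δ N) atTop atTop := by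
        have h := (tendsto_inv_nhdsGT_zero.comp hδlim).const_mul_atTop hc
        refine h.congr fun N => ?_
        simp [div_eq_mul_inv]
      exact (tendsto_nat_floor_atTop.comp h1).eventually_ge_atTop 1
    have hid : ∀ᶠ N in atTop, f (q N * s) = M (q N) * f s := by
      filter_upwards [hkev] with N hk1
      have hl : 1 ≤ N + 1 := Nat.succ_le_succ (Nat.zero_le N)
      have hqN : q N = (kN N : ℝ) / ((N + 1 : ℕ) : ℝ) := by
        rw [hq, hδ]
        push_cast
        ring
      rw [hqN, hrat _ _ hk1 hl s hs, hMrat _ _ hk1 hl]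
    have hL : Tendsto (fun N => f (q N * s)) atTop (𝓝 (f (c * s))) :=
      (hfat _ (mul_pos hc hs)).tendsto.comp (hqlim.mul_const s)
    have hRlim : Tendsto (fun N => M (q N) * f s) atTop (𝓝 (M c * f s)) := by
      have hMc : Tendsto (fun N => M (q N)) atTop (𝓝 (M c)) :=
        ((hfat c hc).tendsto.comp hqlim).div_const (f 1)
      exact hMc.mul_const _
    exact tendsto_nhds_unique (hL.congr' hid) hRlim
  -- `M` is positive, multiplicative and continuous on `(0,∞)`
  have hMpos : ∀ c, 0 < c → 0 < M c := fun c hc => div_pos (hfpos c hc) (hfpos 1 one_pos)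
  have hMmul : ∀ c d, 0 < c → 0 < d → M (c * d) = M c * M d := by
    intro c d hc hd
    have h := hMid c hc d hd
    rw [hM]
    simp only []
    rw [h, mul_div_assoc]
  have hMcont : ∀ c, 0 < c → ContinuousAt M c := fun c hc => (hfat c hc).div_const (f 1)
  -- Cauchy: `M(c) = c^{-a}`
  set φ : ℝ →+ ℝ := AddMonoidHom.mk' (fun t => Real.log (M (Real.exp t))) (by
    intro t t'
    change Real.log (M (Real.exp (t + t'))) = Real.log (M (Real.exp t)) + Real.log (M (Real.exp t'))
    rw [Real.exp_add, hMmul _ _ (Real.exp_pos t) (Real.exp_pos t'),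
      Real.log_mul (hMpos _ (Real.exp_pos t)).ne' (hMpos _ (Real.exp_pos t')).ne']) with hφ
  have hφ_apply : ∀ t, φ t = Real.log (M (Real.exp t)) := fun t => rfl
  have hφcont : Continuous φ := by
    rw [continuous_iff_continuousAt]
    intro t
    show ContinuousAt (fun t => Real.log (M (Real.exp t))) t
    have h1 : ContinuousAt (fun t => M (Real.exp t)) t :=
      (hMcont _ (Real.exp_pos t)).comp Real.continuous_exp.continuousAt
    exact h1.log (hMpos _ (Real.exp_pos t)).ne'
  have hlin : ∀ t, φ t = t * φ 1 := by
    intro t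
    have := map_real_smul φ hφcont t 1
    rwa [smul_eq_mul, mul_one, smul_eq_mul] at this
  have hMpow : ∀ c, 0 < c → M c = c ^ (φ 1) := by
    intro c hc
    have h1 : M c = Real.exp (φ (Real.log c)) := by
      rw [hφ_apply, Real.exp_log hc, Real.exp_log (hMpos c hc)]
    rw [h1, hlin, Real.rpow_def_of_pos hc]
  refine ⟨-φ 1, fun k hk => ?_⟩
  have hk0 : (0:ℝ) < k := by exact_mod_cast hk
  have hLk' : Lk k = (k : ℝ) ^ (-(-φ 1)) := by
    rw [neg_neg, ← hMpow k hk0]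
    have h := hMrat k 1 hk le_rfl
    have hL1 : Lk 1 = 1 := by
      have h1 := hscale 1 le_rfl 1 one_pos
      rw [Nat.cast_one, mul_one] at h1
      nlinarith [hfpos 1 one_pos]
    rw [Nat.cast_one, div_one, hL1, div_one] at h
    exact h.symm
  rw [← hLk']
  exact hLk k hk

end Summit.CriticalPhenomena.Ising3DConformalLimit.HarmonicMomentsIsotropyTwoPoint.RayRV

end
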